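import Mathlib
import HarnessLib
import Summits.QuantumFields.YangMills.Theses.ConvexGribovBody
import Summits.QuantumFields.YangMills.Theses.SmallCircleAnchor
import Summits.QuantumFields.YangMills.Theses.HyperbolicRegulator
import Summits.QuantumFields.YangMills.Theses.ContractibleFibre
import Summits.QuantumFields.YangMills.Theses.ComplexCouplingChannel
import Summits.QuantumFields.YangMills.Theses.DoublingDefect
import Summits.QuantumFields.YangMills.Theses.NoiseSynchronisation
import Summits.QuantumFields.YangMills.Theses.DirichletWindow
import Summits.QuantumFields.YangMills.Theorems.ComplexCouplingChannelContinuumLegGivenGapSplit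
import Summits.QuantumFields.YangMills.Theorems.ParabolicTrajectoryContinuumLimitOnTrajectoryDefsC
import Summits.QuantumFields.YangMills.Theorems.ComplexCouplingChannelContinuumLegGivenGapProductToUniformLinearity
import Summits.QuantumFields.YangMills.Theorems.ComplexCouplingChannelContinuumLegGivenGapProductToUniformNearDiagonal
import Summits.QuantumFields.YangMills.Theorems.ComplexCouplingChannelContinuumLegGivenGapProductToUniformOffsets
import Summits.QuantumFields.YangMills.Theorems.ComplexCouplingChannelContinuumLegGivenGapProductToUniformLocalBound
import Summits.QuantumFields.YangMills.Theorems.ComplexCouplingChannelContinuumLegGivenGapProductToUniformGevreyGlue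
import Summits.QuantumFields.YangMills.Theorems.ComplexCouplingChannelContinuumLegGivenGapProductToUniformGevreyStep
import Summits.QuantumFields.YangMills.Theorems.ComplexCouplingChannelContinuumLegGivenGapProductToUniformDefs
import Summits.QuantumFields.YangMills.Theorems.ComplexCouplingChannelContinuumLegGivenGapProductToUniformGlue
import Summits.QuantumFields.YangMills.Theorems.ComplexCouplingChannelContinuumLegGivenGapStubPtuGeometry
import Summits.QuantumFields.YangMills.Theorems.ComplexCouplingChannelContinuumLegGivenGapStubPtuDerivatives
import Summits.QuantumFields.YangMills.Theorems.ComplexCouplingChannelContinuumLegGivenGapStubPtuAnalysis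
import Summits.QuantumFields.YangMills.Theorems.ComplexCouplingChannelContinuumLegGivenGapStubPtuAssembly
import Literature.Probability.LatticeModels.ChessboardEstimateEvenTorus
import Literature.Probability.LatticeModels.ChessboardEstimateAssignments
import Summits.QuantumFields.YangMills.Theorems.ComplexCouplingChannelContinuumLegGivenGapAlternatingArraysDefs
import Summits.QuantumFields.YangMills.Theorems.ComplexCouplingChannelContinuumLegGivenGapStubAbstractChessboard
import Summits.QuantumFields.YangMills.Theorems.ComplexCouplingChannelContinuumLegGivenGapStubArrayFunctional

/-!
# Line `alternating-curvature-arrays` — crux `ContinuumLegGivenGap` (stmt-QuantumFields-15828)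

Skeleton of the crux idea `Cruxes/ContinuumLegGivenGap/Ideas/alternating-curvature-arrays.md` (ideator 2, r1;
triage TRIAGE-r1-1 / TRIAGE-r1-2: pass + sharpenings S1 PARITY, S2 GRID SHIFTS, S3 ALIGNMENT, free exponent `p`),
planner `planner-cruxplan-stmt-QuantumFields-15828-alternating-curvatur-0`, 2026-08-17.

## What the line does

The crux is `∀ G` compact simple, `GapHyp G → Concl G`.  The LANDED def-free split
`…Theorems.ContinuumLegGivenGap.ContinuumLegGivenGap_of_subs_all : XiDiverges → ⟨child 2⟩ → ⟨child 3⟩ → all decls`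
(p145379 ff., `Theorems/ComplexCouplingChannelContinuumLegGivenGapSplit.lean`) reduces it to criticality (stmt-8941, BY
NAME), the volume-uniform UV engine ⟨child 2⟩ = (UUVB) ∧ (ND) ∧ (ROT₃₄₅) at the gap-pinned unit, and the NLO skewness
window ⟨child 3⟩.  This line supplies the (UUVB) third of child 2 — the k-UNIFORM E0′ bounds for all canonically
normalised, exactly centred plaquette strings, the obstruction named by `Disproof.lean` §5 NM B3 — from REFLECTION
POSITIVITY: a LINEAR chessboard estimate (Fröhlich–Israel–Lieb–Simon 1978 Thm 2.2/4.1) for smeared plaquette fields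
supported two lattice units deep inside the cells of an ALTERNATING site/link-wall grid of half-odd mesh `3^m / 2` on the
scheme's ODD tori `2L+1 = 3^M` (S1: `2·3^(M-m)` congruent cells per axis, permuted by the dihedral group generated by
the `3^(M-m)` reflections, each fixing one site plane and the antipodal link plane — the tree's odd-torus RP
`wilsonExpectation_oddReflectionPositive`), which bounds an `n`-point function of fields in DISTINCT cells by the
product of ONE-BODY array exponents `arrayRoot = ⟨∏_{cells} mirror copies⟩^(1/#cells)` (`stub_chessboard`); ONE
k-uniform bound on that exponent per scale (`stub_arrayExponent`, (CB) — THE BET of the line); and a Whitney / grid-shift /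
nuclear step turning the product bound on tensor test functions into (UUVB) (`stub_productToUniform`, S2/S3).  The other
two thirds of child 2 ((ND) two-point floor, (ROT₃₄₅)) and child 3 are the line's SOCKETS (`stub_floorAndRotation`,
`stub_skewWindow` — the latter is the registered signature verbatim), and `XiDiverges` enters by name.

## Reshape c14-1 (lead c14, 2026-08-17)
`stub_chessboard` is no longer a stub: it is DERIVED (§3b) from two registered stubs — `stub_abstractChessboard` (the
Fröhlich–Israel–Lieb–Simon chessboard estimate for LABEL ASSIGNMENTS on the block torus `(ℤ/N)^d`, `N` even: pure
combinatorics, a port of the tree's set-function `chessboard_pow_le_even` to assignments `σ : BlockIdx d N → ι` with the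
symmetrisations `asgSymP/asgSymM` of §2b) and `stub_arrayFunctional` (the Wilson reflection-positivity INSTANCE: an array
functional `ψ` on assignments of the `n` smeared plaquette fields to the `numCells^4` cells with RP positivity, the
reflection Cauchy–Schwarz inequality, `ψ(const none) = 1`, `ψ(const i) = arrayMean(fᵢ)`, and the tensor bookkeeping
`‖canonDistribution(⊗fᵢ)‖ = |ψ σ₀|`).  Stubs now: abstractChessboard, arrayFunctional, arrayExponent (bet, held by the lead),
productToUniform, floorAndRotation, skewWindow (6 ≤ stubs_max).

## Reshape c14-2 (lead c14, wave 1 integrated, 2026-08-17)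
LANDED and imported BY NAME: the Defs §1–§2 (`Theorems/ComplexCouplingChannelContinuumLegGivenGapAlternatingArraysDefs.lean`,
p158685, namespace `…Theorems.ContinuumLegGivenGap.AlternatingArrays`, opened below — the local copies are gone),
the assignment symmetrisations + abstract chessboard (`Literature/Probability/LatticeModels/ChessboardEstimateAssignments.lean`,
p159580: `asgSymP`, `asgSymM`, `chessboard_abs_pow_le_prod_const`), `stub_abstractChessboard` (p159986,
`Theorems/…StubAbstractChessboard.lean`) and `stub_arrayFunctional` (p161571, `Theorems/…StubArrayFunctional.lean`, with helper
files …ArrayFunctional{Reflection,Grid,RP,Obs,Psi}.lean p159850/p160159/p160531/p160761/p161322).  `stub_chessboard` (§3b) is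
therefore a THEOREM.  Helpers of `stub_productToUniform` landed: …ProductToUniform{Linearity,NearDiagonal,Offsets,LocalBound,
GevreyGlue,GevreyStep}.lean (p160113/p159896/p159592/p160873/p161296/p161519).  Open stubs: arrayExponent (bet), productToUniform,
floorAndRotation (socket, stub-blocked on child 2), skewWindow (socket, stub-blocked on child 3).

## Reshape c14-5 (lead c14, 2026-08-17T14:40Z) — THE LINE IS REDUCED TO ITS BET + TWO SOCKETS
`stub_ptuAssembly` LANDED (p166532): `stub_productToUniform` ((PB) ⇒ (UUVB)) is a theorem (`arrays_productToUniform`,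
`Theorems/…ArraysReductionPTU.lean`).  Remaining sorries = the three OPEN-PROBLEM-CLASS statements: `stub_arrayExponent` (the bet (CB):
ONE k-uniform bound on the one-body array exponent per scale — UV content of weak-coupling YM₄), `stub_floorAndRotation` (child 2 ∖ (UUVB),
tail-shaped: (ND) ∧ (ROT₃₄₅)), `stub_skewWindow` (child 3).  Tree-level statement of the line:
`ContinuumLegGivenGap_of_arrays hFR hCB arrays_productToUniform hSW : XiDiverges → crux` (all seven route decls; p162793 + ArraysReductionPTU).

## Reshape c14-4 (lead c14, wave 2 integrated, 2026-08-17)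
LANDED and imported by name: PTU Defs (p163024), Glue (assembly worker), `stub_ptuGeometry` p164938, `stub_ptuDerivatives` p165158,
`stub_ptuAnalysis` p164140 (+ 8 helper files).  Open stubs: arrayExponent (bet), ptuAssembly (assembly worker running; helper files
PtuAssembly{Kit,Far,FarSum} landed), floorAndRotation, skewWindow.

## Reshape c14-3 (lead c14, 2026-08-17)
`stub_productToUniform` is DERIVED (§3c) from a four-piece sub-skeleton designed by the wave-1 worker on top of its six landed
helper files: `stub_ptuGeometry` (coverage / supports / index-set facts / counting), `stub_ptuDerivatives` (Gevrey-type derivative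
bounds of cut-offs and piece weights), `stub_ptuAnalysis` (abstract flat/decay bound + seam), `stub_ptuAssembly`
(piece₁ → piece₂ → piece₃ → registered signature).  The shared Whitney-system definitions (§3c.1) are proposed as
`Theorems/…ProductToUniformDefs.lean` (p163024, review lane).  Also LANDED meanwhile: `arrays_chessboard` (p162501,
`Theorems/…ArraysChessboard.lean`) and the line's REDUCTION `ContinuumLegGivenGap_of_arrays : XiDiverges → ⟨FR⟩ → ⟨CB⟩ → ⟨PTU⟩ →
⟨SW⟩ → crux` (+ twins; p162793, `Theorems/…ArraysReduction.lean`).  Registered stubs now (7 = stubs_max): arrayExponent (bet),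
floorAndRotation, skewWindow, stub_ptuGeometry, stub_ptuDerivatives, stub_ptuAnalysis, stub_ptuAssembly.

## Layout
* §1 geometry of the alternating grid (lattice units; physical cells at spacing `a`), the scale-invariant cell norm;
* §2 the mirror array: `cellMap`/`siteMap`/`cornerMap` (transport of a plaquette from its home cell to any cell of the
  grid: translation by an even number of half-cells, or reflection in a wall + translation, with the base-corner shift
  of a reflected plaquette), `arrayObs`, `arrayMean`, `arrayRoot`; the interface `ProductBound`;
* §3 the five stubs;
* §4 the composition (PROVED): `productBound_of_chessboard_of_exponent`, `uvEngine_of_stubs` (child 2 re-assembled,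
  torus family `𝓛 k = {L ≥ Λ k, 2L+1 = 3^M}`), `ContinuumLegGivenGap_of` (+ twins for the six other route decls).

`lean check`: sorries ONLY in the five `stub_*`; `ContinuumLegGivenGap_of` concludes
`Summit.QuantumFields.YangMills.Theses.ComplexCouplingChannel.ContinuumLegGivenGap` BY NAME.
Disproof used: `crux_false_without_nonabelian/linear` are honoured — `hG : IsCompactSimpleLieGroup G` is consumed by
`stub_floorAndRotation`, `stub_arrayExponent`, `stub_skewWindow` and the landed glue; §3 (`abstract_lock_false`) is not
re-incurred (all uniformity is along the locked witness SEQUENCE handed over by the landed 17-RP lock inside the glue);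
§5 NM B3 is exactly what (UUVB) ⇐ (CB) discharges.  No landed `Negative/` lemma has the shape of any stub.
-/

set_option autoImplicit false

noncomputable section

namespace Summit.QuantumFields.YangMills.Cruxes.ContinuumLegGivenGap.AlternatingCurvatureArrays

open scoped SchwartzMap
open Filter Topology MeasureTheory
open Literature.MathematicalPhysics.QuantumFieldTheory Literature.MathematicalPhysics.QuantumLattice
  Literature.MathematicalPhysics.AQFT Literature.Probability.LatticeModels
open Summit.QuantumFields.YangMills.Theses
open Summit.QuantumFields.YangMills.Cruxes.ContinuumLimitOnTrajectory.TwoOrbitSynchronisation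
  (PlaqIdx plaq canonDistribution UUVB PolyVolumeGrowth)
open Summit.QuantumFields.YangMills.Theorems.ContinuumLegGivenGap.AlternatingArrays
open Summit.QuantumFields.YangMills.Theorems.ContinuumLegGivenGap
open Summit.QuantumFields.YangMills.Theorems.ContinuumLimitExists.Negative (obsOf centredMoment)
open scoped Classical ContDiff BigOperators

local notation "𝔼" => EuclideanSpace ℝ (Fin 4)

/-! ## §1–§2b (definitions): LANDED — `Theorems/ComplexCouplingChannelContinuumLegGivenGapAlternatingArraysDefs.lean`
(`cellSide … ProductBound`, `numCells_eq_two_mul`) and `Literature/Probability/LatticeModels/ChessboardEstimateAssignments.lean`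
(`asgSymP`, `asgSymM`); opened above. -/

/-! ## §3 The stubs -/

/-! `stub_abstractChessboard` (p159986) and `stub_arrayFunctional` (p161571): LANDED, imported by name (see header). -/

/-- `stub_arrayExponent` — **(CB), THE BET of the line: one k-uniform exponent per scale.**  Along a locked critical IR
datum of the crux (couplings `β_k → ∞`, UNIFORM torus clustering at lattice rate `mh k` beyond `S₁ k`) and for every
admissible engine choice (`a`, `φ`, `Δ₀` with `Δ₀ a_k ≤ mh (φ k)` — the unit is at or below the correlation length —
and a volume threshold `Λ₀ ≥ S₁ ∘ φ`), there are a larger volume threshold `Λ`, constants `C, p`, a flatness order `s`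
and `k₀` such that for all `k ≥ k₀`, all triadic tori `L ≥ Λ k`, all admissible levels, offsets, home cells in the
central half-box, orientations and real `f` supported in the core:
`arrayRoot ≤ C · max(ℓ, ℓ⁻¹)^p · cellNorm s ℓ f`, `ℓ = a_k 3^m / 2`.
Why plausibly true: the lattice field is bounded, so at each `k` every array moment is finite and the content is
k-UNIFORMITY; free benchmark (lattice Maxwell Wick square): array moments are complexified-Gaussian expectations with
the same-cell-deleted covariance, UV-finite across walls by core support / flatness (`∫∫ sᴺtᴺ(s+t)⁻⁵ < ∞ iff 2N > 3`),
exponential in the number of cells by a hafnian bound, `γ_free ≲ ℓ⁻⁴ (ξ/ℓ)^{O(1)}` (TRIAGE-r1-2) — hence the free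
exponent `p`; at the IR end (`ℓ ≫ 1/Δ₀`) adjacent copies decouple at rate `e^{-Δ₀ a_k · dist}` from the UNIFORM
clustering handed over, `γ ~ ℓ^{3-2s}`; in between, `O(g²(ℓ))` corrections (asymptotic freedom).  Honest: on
`a^{4/(4+p)} ≲ ℓ ≲ 1` this is a UV statement of the truth-content of factorial-free tree bounds (card, Barriers); no
expansion-free tool is named beyond transfer-operator / variational / flow control of ONE maximally symmetric
configuration per scale.  Open-problem class; everything else in the line is L-sized or a socket. [folklore] -/
theorem stub_arrayExponent :
    ∀ (G : Type) [Group G] [TopologicalSpace G] [IsTopologicalGroup G] [CompactSpace G]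
      [MeasurableSpace G] [BorelSpace G], IsCompactSimpleLieGroup G →
      ∀ (r : LatticeRep G) (β : ℕ → ℝ) (mh : ℕ → ℝ) (S₁ : ℕ → ℕ),
      Tendsto β atTop atTop → (∀ k, 0 < mh k) →
      (∀ A B : YMSpecies G, ∃ C : ℝ, ∀ k S n : ℕ, S₁ k ≤ S → n ≤ S →
        |latticeConnectedCorr r.ρ (β k) (2 * S + 1) A.F B.F n| ≤ C * Real.exp (-(mh k * n))) →
      ∀ (a : ℕ → ℝ) (φ : ℕ → ℕ) (Δ₀ : ℝ) (Λ₀ : ℕ → ℕ),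
        (∀ k, 0 < a k) → StrictMono φ → 0 < Δ₀ → (∀ k, Δ₀ * a k ≤ mh (φ k)) → (∀ k, S₁ (φ k) ≤ Λ₀ k) →
        ∃ (Λ : ℕ → ℕ) (C : ℝ) (p s k₀ : ℕ), (∀ k, Λ₀ k ≤ Λ k) ∧ 0 ≤ C ∧
          ∀ k : ℕ, k₀ ≤ k → ∀ L : ℕ, Λ k ≤ L → IsTriadic L →
          ∀ (m : ℕ) (v z₀ : Fin 4 → ℤ) (q : PlaqIdx) (f : 𝓢(𝔼, ℝ)),
            LevelAdmissible L m → CellInHalfBox L m v z₀ → tsupport f ⊆ physCore (a k) m v z₀ →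
            arrayRoot r (β (φ k)) (a k) L m v z₀ q f ≤
              C * max (a k * cellSide m) (a k * cellSide m)⁻¹ ^ p * cellNorm s (a k * cellSide m) f := by
  sorry

/-! ## §3c Sub-skeleton of `stub_productToUniform` ((PB) ⇒ (UUVB)): Whitney decomposition by admissible deep cores
(lead c14 / worker W3; landed helpers: …ProductToUniform{Linearity,NearDiagonal,Offsets,LocalBound,GevreyGlue,GevreyStep}.lean) -/

/-! ### §3c.1–§3c.2 LANDED: `Theorems/…ProductToUniformDefs.lean` (p163024: `ptuStep … ptuWeight` + regularity lemmas) and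
`Theorems/…ProductToUniformGlue.lean` (arity 0/1, `ptu_canonDistribution_decomp`); imported by name. -/

/-! ### §3c.3 The three pieces: LANDED — `stub_ptuGeometry` (p164938, + PtuGeometry{Basics,Coverage,Counting} p164009/p164483/p164698),
`stub_ptuDerivatives` (p165158, + PtuDerivatives{OneDim,Supports,Blocks,Normaliser} p164084/p164276/p164471/p164799),
`stub_ptuAnalysis` (p164140); imported by name (`…StubPtuGeometry/Derivatives/Analysis.lean`). -/

/-! ### §3c.4 The assembly: LANDED — `stub_ptuAssembly` (p166532, + PtuAssembly{Kit,Far,FarSum,Level,NearOut}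
p163781/p164256/p164855/p165452/p165890); imported by name.  Hence `stub_productToUniform` below is a THEOREM (also landed on its own as
`arrays_productToUniform`, `Theorems/…ArraysReductionPTU.lean`). -/

/-- `stub_productToUniform` — **(PB) ⇒ (UUVB): the Whitney / grid-shift / nuclear step** (S2, S3; pure lattice
analysis, size L).  For an off-diagonal Schwartz `F` on `(ℝ⁴)^p`: dyadic-in-`ρ` (ratio 3) partition of unity in the
separation `ρ(x) = min_{i≠i'} |xᵢ - x_{i'}|_∞`; at separation scale `ρ` choose the admissible level with
`a 3^m/2 ∈ [ρ/6, ρ/2)` (distinct points ⇒ distinct cells for EVERY offset) and the `(2p+1)^4` lattice offsets `v` in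
steps of `⌊3^m/(2(2p+1))⌋`, for each of which a smooth cut-off keeps all `p` points `≥ 3^m/(4(2p+1)) ≥ 2` lattice units
inside their cells (some offset is good for every configuration: each point spoils `≤ 2` offsets per axis); expand each
localised piece on its product of cells in a tensor (Fourier × core cut-off, real and imaginary parts) series with
coefficients `≲ (1+|m|)^{-p(s+5)} · (p/ℓ)^{p(s+5)} · sup|∂^{≤p(s+5)} F|` and apply (PB) termwise (the canonical
distribution at fixed `k` is a finite sum of point evaluations, hence sup-norm continuous); flatness of `F` at the
diagonal (`|∂^α F| ≤ C ρ^M |F|_{|α|+M}`) pays `ℓ^{-pn}`, the cell count and the cut-off losses, Schwartz decay pays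
`max(ℓ,ℓ⁻¹)^p` for `ℓ > 1` and the torus seam (`PolyVolumeGrowth`: everything polynomial in `ℓ/a ≤ L` is beaten by
`|x| ≳ a L / 8`); separations `ρ < 24(2p+1) a_k` are bounded TRIVIALLY (bounded plaquettes, `|Re tr ρ(U)| ≤ N`):
`(#sites)^p sup|F| ≤ (Cp)^{4p} (p a)^M a^{-4}`-type bounds, factorial in `p` and uniform in `k` (when `p a_k ≥ 1` even
`a_k^{-4p} ≤ p^{4p}`).  All losses are `C^p (p!)^{β'}` with a Schwartz index linear in `p` — the shape of (UUVB).
Whitney-type coverings avoiding the fat diagonal are not in Mathlib (to be built, M).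
RESHAPE c14-3: DERIVED below (§3c) from the registered pieces `stub_ptuGeometry`, `stub_ptuDerivatives`, `stub_ptuAnalysis`,
`stub_ptuAssembly` (sub-skeleton by worker W3; helpers P1–P4c landed). [folklore] -/
theorem stub_productToUniform :
    ∀ (G : Type) [Group G] [TopologicalSpace G] [IsTopologicalGroup G] [CompactSpace G]
      [MeasurableSpace G] [BorelSpace G] (r : LatticeRep G) (sch : SpeciesScheme (YMSpecies G)),
      PolyVolumeGrowth sch → ProductBound r sch → UUVB r sch :=
  stub_ptuAssembly stub_ptuGeometry stub_ptuDerivatives stub_ptuAnalysis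

/-- `stub_floorAndRotation` — **SOCKET: child 2 minus (UUVB)** — the IR / symmetry two-thirds of the volume-uniform UV
engine `stub_uvPackageVol` of the dead line `Sketch` (registered on stmt-15828), with the admissible torus family made
TAIL-shaped (`L ≥ Λ₀ k`, which every thermodynamic proof delivers and which lets the chessboard side intersect its own
threshold and the triadic sizes): at some faithful `r`, for every locked critical IR datum, spacings `Δ₀ a_k ≤ mh (φ k)`,
a volume threshold `Λ₀ ≥ S₁ ∘ φ` of polynomial growth, and for EVERY canonically normalised exactly centred scheme on
`(a, β ∘ φ, L ≥ Λ₀)`: (ND) a two-point floor on one time-ordered OS pair (forces the engine to realise the two-sided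
pin `a_k ≍ mh (φ k)`: dimensional transmutation against the LOCKED mass) and (ROT₃₄₅) asymptotic invariance under the
Pythagorean rotation of the `(x⁰,x¹)`-plane.  Open (the (ND) half is `IsNontrivial`-class dynamical content; (ROT) is
the conceded E1 burden); NOT this line's lever — shared with every line of the crux (necessity analysis of
`Lines/SketchDead.md` §3). [folklore] -/
theorem stub_floorAndRotation :
    ∀ (G : Type) [Group G] [TopologicalSpace G] [IsTopologicalGroup G] [CompactSpace G]
      [MeasurableSpace G] [BorelSpace G], IsCompactSimpleLieGroup G → ∃ r : LatticeRep G,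
      ∀ (β : ℕ → ℝ) (mh : ℕ → ℝ) (S₁ : ℕ → ℕ) (K : ℝ), Tendsto β atTop atTop → (∀ k, 0 < mh k) → 0 < K →
      (∀ A B : YMSpecies G, ∃ C : ℝ, ∀ k S n : ℕ, S₁ k ≤ S → n ≤ S →
        |latticeConnectedCorr r.ρ (β k) (2 * S + 1) A.F B.F n| ≤ C * Real.exp (-(mh k * n))) →
      (∀ k S₀ : ℕ, ∃ A B : YMSpecies G, ∀ C : ℝ, ∃ S n : ℕ, S₀ ≤ S ∧ n ≤ S ∧
        C * Real.exp (-(K * mh k * n)) < |latticeConnectedCorr r.ρ (β k) (2 * S + 1) A.F B.F n|) →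
      Tendsto mh atTop (𝓝 0) →
      ∃ (a : ℕ → ℝ) (φ : ℕ → ℕ) (Δ₀ : ℝ) (Λ₀ : ℕ → ℕ),
        (∀ k, 0 < a k) ∧ StrictMono φ ∧ 0 < Δ₀ ∧ (∀ k, Δ₀ * a k ≤ mh (φ k)) ∧ (∀ k, S₁ (φ k) ≤ Λ₀ k) ∧
        (∃ N : ℕ, 1 ≤ N ∧ ∀ᶠ k in atTop, ∀ S : ℕ, Λ₀ k ≤ S → (a k)⁻¹ ≤ (a k * (S : ℝ)) ^ N) ∧
      ∀ (sch : SpeciesScheme (YMSpecies G)), (∀ k, sch.a k = a k) → (∀ k, sch.β k = β (φ k)) →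
        (∀ k, Λ₀ k ≤ sch.L k) →
      ∀ (LS : (k n : ℕ) → SchwartzMap (Fin n → EuclideanSpace ℝ (Fin 4)) ℂ → ℂ),
      (∀ (k n : ℕ) (F : SchwartzMap (Fin n → EuclideanSpace ℝ (Fin 4)) ℂ), LS k n F =
        ∫ U : GaugeConfig 4 (sch.side k) G, ∑ x : Fin n → ↥(Literature.Probability.LatticeModels.box 4 (sch.L k)),
          F (fun i => sch.a k • siteToE ↑(x i)) *
            ∏ i, ((sch.c r.curvature k * sch.a k ^ 4 *
              (r.curvature.F (Literature.MathematicalPhysics.QuantumLattice.configShift (-↑(x i)) (Literature.MathematicalPhysics.QuantumLattice.torusLift (sch.side k) U)) - sch.m r.curvature k) : ℝ) : ℂ)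
          ∂(wilsonMeasure r.ρ (sch.β k))) →
      (∀ k : ℕ, sch.m r.curvature k =
        ∫ U : GaugeConfig 4 (sch.side k) G, r.curvature.F (Literature.MathematicalPhysics.QuantumLattice.torusLift (sch.side k) U) ∂(wilsonMeasure r.ρ (sch.β k))) →
      (∀ k : ℕ, sch.c r.curvature k = (sch.a k ^ 4)⁻¹) →
      (∃ (f g : SchwartzMap (Fin 1 → EuclideanSpace ℝ (Fin 4)) ℂ)
        (H : SchwartzMap (Fin (1 + 1) → EuclideanSpace ℝ (Fin 4)) ℂ),
        IsTimeOrdered f ∧ IsTimeOrdered g ∧ IsAppendTensorOf H (osAdjoint f) g ∧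
          ∃ δ : ℝ, 0 < δ ∧ ∀ᶠ k in atTop, δ ≤ ‖LS k (1 + 1) H‖) ∧
      (∀ R : EuclideanSpace ℝ (Fin 4) ≃ₗᵢ[ℝ] EuclideanSpace ℝ (Fin 4),
        R (EuclideanSpace.single 0 1) =
          (3 / 5 : ℝ) • EuclideanSpace.single 0 1 + (-(4 / 5) : ℝ) • EuclideanSpace.single 1 1 →
        R (EuclideanSpace.single 1 1) =
          (4 / 5 : ℝ) • EuclideanSpace.single 0 1 + (3 / 5 : ℝ) • EuclideanSpace.single 1 1 →
        R (EuclideanSpace.single 2 1) = EuclideanSpace.single 2 1 →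
        R (EuclideanSpace.single 3 1) = EuclideanSpace.single 3 1 →
        ∀ (n : ℕ) (F : SchwartzMap (Fin n → EuclideanSpace ℝ (Fin 4)) ℂ), IsOffDiagonal F →
          Tendsto (fun k : ℕ => LS k n (linActMulti R F) - LS k n F) atTop (𝓝 0)) := by
  sorry

/-- `stub_skewWindow` — **SOCKET: child 3, the NLO skewness window of `tr F²`** — VERBATIM the registered stub of the
dead line `Sketch` (reshape 9; open, stmt-9118 class with (CL) ↦ (CL-t)): for every weak-coupling scheme pinned by
(VS), (UVB), (ND), (CL-t), some sequence of off-diagonal triangle tensors with positive weights has normalised lattice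
third cumulants converging, first in `k` along `φ` then in `j`, to a non-zero `s₃` (the tree term vanishes by duality
selection: landed `trace_twoForm_triple_eq_zero`; first rungs typed in `Ideas/duality-selection-nlo-skewness.md`).
Not this line's lever. [folklore] -/
theorem stub_skewWindow :
    ∀ (G : Type) [Group G] [TopologicalSpace G] [IsTopologicalGroup G] [CompactSpace G]
      [MeasurableSpace G] [BorelSpace G], IsCompactSimpleLieGroup G →
      ∀ (r : LatticeRep G) (sch : SpeciesScheme (YMSpecies G))
        (LS : (k n : ℕ) → SchwartzMap (Fin n → EuclideanSpace ℝ (Fin 4)) ℂ → ℂ),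
      (∀ (k n : ℕ) (F : SchwartzMap (Fin n → EuclideanSpace ℝ (Fin 4)) ℂ), LS k n F =
        ∫ U : GaugeConfig 4 (sch.side k) G, ∑ x : Fin n → ↥(box 4 (sch.L k)),
          F (fun i => sch.a k • siteToE ↑(x i)) *
            ∏ i, ((sch.c r.curvature k * sch.a k ^ 4 *
              (r.curvature.F (configShift (-↑(x i)) (torusLift (sch.side k) U)) - sch.m r.curvature k) : ℝ) : ℂ)
          ∂(wilsonMeasure r.ρ (sch.β k))) →
      Tendsto sch.β atTop atTop →
      (∀ k : ℕ, sch.m r.curvature k =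
        ∫ U : GaugeConfig 4 (sch.side k) G, r.curvature.F (torusLift (sch.side k) U) ∂(wilsonMeasure r.ρ (sch.β k))) →
      (∃ (s : ℕ) (α β' : ℝ), ∀ (n : ℕ) (F : SchwartzMap (Fin n → EuclideanSpace ℝ (Fin 4)) ℂ),
        IsOffDiagonal F → ∀ᶠ k in atTop, ‖LS k n F‖ ≤ α * (n.factorial : ℝ) ^ β' * schwartzNorm (n * s) F) →
      (∃ (f g : SchwartzMap (Fin 1 → EuclideanSpace ℝ (Fin 4)) ℂ)
        (H : SchwartzMap (Fin (1 + 1) → EuclideanSpace ℝ (Fin 4)) ℂ),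
        IsTimeOrdered f ∧ IsTimeOrdered g ∧ IsAppendTensorOf H (osAdjoint f) g ∧
          ∃ δ : ℝ, 0 < δ ∧ ∀ᶠ k in atTop, δ ≤ ‖LS k (1 + 1) H‖) →
      (∃ Δ : ℝ, 0 < Δ ∧ ∀ (n m : ℕ) (F : SchwartzMap (Fin n → EuclideanSpace ℝ (Fin 4)) ℂ)
        (G' : SchwartzMap (Fin m → EuclideanSpace ℝ (Fin 4)) ℂ), IsTimeOrdered F → IsTimeOrdered G' →
        ∃ C : ℝ, ∀ t : ℝ, 0 ≤ t → ∀ᶠ k in atTop,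
          ∀ H : SchwartzMap (Fin (n + m) → EuclideanSpace ℝ (Fin 4)) ℂ,
            IsAppendTensorOf H (osAdjoint F) (translateMulti (EuclideanSpace.single 0 t) G') →
              ‖LS k (n + m) H - LS k n (osAdjoint F) * LS k m G'‖ ≤ C * Real.exp (-Δ * t)) →
      ∃ (s₃ : ℂ) (φ : ℕ → ℕ) (f g h : ℕ → SchwartzMap (EuclideanSpace ℝ (Fin 4)) ℂ)
        (F₃ : ℕ → SchwartzMap (Fin 3 → EuclideanSpace ℝ (Fin 4)) ℂ) (w : ℕ → ℝ),
        s₃ ≠ 0 ∧ StrictMono φ ∧ (∀ j, 0 < w j) ∧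
          (∀ j, IsTensorOf (F₃ j) ![f j, g j, h j] ∧ IsOffDiagonal (F₃ j)) ∧
          ∀ ε : ℝ, 0 < ε → ∀ᶠ j in atTop, ∀ᶠ k in atTop, ‖LS (φ k) 3 (F₃ j) / (w j : ℂ) - s₃‖ ≤ ε := by
  sorry

/-! ## §3b `stub_chessboard` DERIVED from `stub_abstractChessboard` + `stub_arrayFunctional` (PROVED) -/

section ChessboardDerived

variable {G : Type} [Group G] [TopologicalSpace G] [IsTopologicalGroup G] [CompactSpace G]
  [MeasurableSpace G] [BorelSpace G]

/-- `stub_chessboard` — **the LINEAR chessboard estimate on the odd torus with alternating walls** (FILS 1978 Thm 2.2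
for the mean-zero smeared plaquette fields, one per occupied cell, on the torus of side `2L_k+1` with
`3^(m+1) ∣ 2L_k+1`): every array expectation is `≥ 0` and `|⟨∏ᵢ Φ(fᵢ)⟩| ≤ ∏ᵢ arrayRoot(fᵢ)` for fields in pairwise
distinct cells.  DERIVED (reshape c14-1): the abstract assignment chessboard `stub_abstractChessboard` applied to the
array functional of `stub_arrayFunctional`; the product of constants collapses to `∏ᵢ arrayMean(fᵢ)` (unit label
elsewhere), and the `N^4`-th root is taken factorwise. [folklore] -/
theorem stub_chessboard :
    ∀ (G : Type) [Group G] [TopologicalSpace G] [IsTopologicalGroup G] [CompactSpace G]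
      [MeasurableSpace G] [BorelSpace G] (r : LatticeRep G) (sch : SpeciesScheme (YMSpecies G)) (k m : ℕ),
      0 ≤ sch.β k → LevelAdmissible (sch.L k) m →
      ∀ (v : Fin 4 → ℤ) (n : ℕ) (q : Fin n → PlaqIdx) (z : Fin n → (Fin 4 → ℤ)) (f : Fin n → 𝓢(𝔼, ℝ))
        (F : 𝓢((Fin n → 𝔼), ℂ)),
        (∀ i, CellInHalfBox (sch.L k) m v (z i)) → Function.Injective z →
        (∀ i, tsupport (f i) ⊆ physCore (sch.a k) m v (z i)) → IsTensorOf F (fun i => ofRealTest (f i)) →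
        (∀ i, 0 ≤ arrayMean r (sch.β k) (sch.a k) (sch.L k) m v (z i) (q i) (f i)) ∧
          ‖canonDistribution r sch k n (fun i => plaq r (q i)) F‖ ≤
            ∏ i, arrayRoot r (sch.β k) (sch.a k) (sch.L k) m v (z i) (q i) (f i) := by
  intro G _ _ _ _ _ _ r sch k m hβ hm v n q z f F hbox hz hf hF
  classical
  obtain ⟨w, hw, hw0⟩ := numCells_eq_two_mul hm
  haveI : NeZero (numCells (sch.L k) m) := ⟨by omega⟩
  have hNe : Even (numCells (sch.L k) m) := ⟨w, by omega⟩
  obtain ⟨ψ, e, σ₀, hRP, hone, hmean, he, hσe, hσ0, hcanon⟩ :=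
    stub_arrayFunctional G r sch k m hβ hm v n q z f F hbox hz hf hF (numCells (sch.L k) m) rfl
  have hCB := stub_abstractChessboard 4 (numCells (sch.L k) m) (by norm_num) hNe (Option (Fin n)) ψ hRP σ₀
  -- non-negativity of the array means: a constant assignment is its own positive symmetrisation
  have hnn : ∀ i, 0 ≤ arrayMean r (sch.β k) (sch.a k) (sch.L k) m v (z i) (q i) (f i) := fun i => by
    have h := (hRP 0 0 (fun _ => some i)).1
    rwa [asgSymP_const, hmean] at h
  refine ⟨hnn, ?_⟩
  -- the product of constants collapses to the occupied blocks
  have hprod : ∏ c, ψ (fun _ => σ₀ c) = ∏ i, arrayMean r (sch.β k) (sch.a k) (sch.L k) m v (z i) (q i) (f i) := by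
    have himg : ∀ c ∈ (Finset.univ : Finset _), c ∉ Finset.univ.image e → ψ (fun _ => σ₀ c) = 1 :=
      fun c _ hc => by
        rw [hσ0 c fun i h => hc (Finset.mem_image.2 ⟨i, Finset.mem_univ _, h⟩), hone]
    rw [← Finset.prod_subset (Finset.subset_univ (Finset.univ.image e)) himg,
      Finset.prod_image fun i _ j _ h => he h]
    exact Finset.prod_congr rfl fun i _ => by rw [hσe i, hmean i]
  rw [hprod] at hCB
  rw [hcanon]
  have hN0 : (0 : ℝ) < (numCells (sch.L k) m : ℝ) := by exact_mod_cast (show 0 < numCells (sch.L k) m by omega)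
  have hK : (0 : ℝ) < (numCells (sch.L k) m : ℝ) ^ 4 := by positivity
  have hexp : ((numCells (sch.L k) m ^ 4 : ℕ) : ℝ) * ((1 : ℝ) / (numCells (sch.L k) m : ℝ) ^ 4) = 1 := by
    push_cast; exact mul_one_div_cancel hK.ne'
  calc |ψ σ₀| = (|ψ σ₀| ^ (numCells (sch.L k) m ^ 4)) ^ ((1 : ℝ) / (numCells (sch.L k) m : ℝ) ^ 4) := by
        rw [← Real.rpow_natCast, ← Real.rpow_mul (abs_nonneg _), hexp, Real.rpow_one]
    _ ≤ (∏ i, arrayMean r (sch.β k) (sch.a k) (sch.L k) m v (z i) (q i) (f i)) ^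
          ((1 : ℝ) / (numCells (sch.L k) m : ℝ) ^ 4) :=
        Real.rpow_le_rpow (by positivity) hCB (by positivity)
    _ = ∏ i, arrayRoot r (sch.β k) (sch.a k) (sch.L k) m v (z i) (q i) (f i) := by
        rw [← Real.finsetProd_rpow _ _ fun i _ => hnn i]
        rfl

end ChessboardDerived

/-! ## §4 Composition (PROVED: no `sorry` below this line) -/

section Composition

variable {G : Type} [Group G] [TopologicalSpace G] [IsTopologicalGroup G] [CompactSpace G]
  [MeasurableSpace G] [BorelSpace G]

/-- Triadic torus half-sides are cofinal: `n ≤ (3^M - 1)/2` for some `M`. [folklore] -/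
theorem exists_triadic_ge (n : ℕ) : ∃ L : ℕ, n ≤ L ∧ IsTriadic L := by
  obtain ⟨M, hM⟩ := pow_unbounded_of_one_lt (2 * n + 1) (by norm_num : (1 : ℕ) < 3)
  -- `3^M` is odd, so `3^M = 2L+1` with `L = (3^M - 1)/2 ≥ n`
  obtain ⟨L, hL⟩ : Odd (3 ^ M) := Odd.pow (by decide : Odd 3)
  exact ⟨L, by omega, M, by omega⟩

/-- The array exponent is non-negative once the array expectation is. [folklore] -/
theorem arrayRoot_nonneg (r : LatticeRep G) (βv a : ℝ) (L m : ℕ) (v z₀ : Fin 4 → ℤ) (q : PlaqIdx)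
    (f : 𝓢(𝔼, ℝ)) (h : 0 ≤ arrayMean r βv a L m v z₀ q f) : 0 ≤ arrayRoot r βv a L m v z₀ q f :=
  Real.rpow_nonneg h _

/-- **(CHESS) ∧ (CB) ⇒ (PB)** along a scheme pinned to the engine data: the product of array exponents is bounded
factor by factor. [folklore] -/
theorem productBound_of_chessboard_of_exponent (r : LatticeRep G) (sch : SpeciesScheme (YMSpecies G))
    {β : ℕ → ℝ} {φ : ℕ → ℕ} {a : ℕ → ℝ} {Λ : ℕ → ℕ} {C : ℝ} {p s k₀ : ℕ}
    (hsa : ∀ k, sch.a k = a k) (hsβ : ∀ k, sch.β k = β (φ k)) (hsL : ∀ k, Λ k ≤ sch.L k ∧ IsTriadic (sch.L k))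
    (hβ : Tendsto β atTop atTop) (hφ : StrictMono φ) (hC : 0 ≤ C)
    (hCB : ∀ k : ℕ, k₀ ≤ k → ∀ L : ℕ, Λ k ≤ L → IsTriadic L →
      ∀ (m : ℕ) (v z₀ : Fin 4 → ℤ) (q : PlaqIdx) (f : 𝓢(𝔼, ℝ)),
        LevelAdmissible L m → CellInHalfBox L m v z₀ → tsupport f ⊆ physCore (a k) m v z₀ →
        arrayRoot r (β (φ k)) (a k) L m v z₀ q f ≤
          C * max (a k * cellSide m) (a k * cellSide m)⁻¹ ^ p * cellNorm s (a k * cellSide m) f) :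
    ProductBound r sch := by
  -- the couplings of the scheme are eventually non-negative
  have hβ' : Tendsto (fun k => sch.β k) atTop atTop := by
    rw [show (fun k => sch.β k) = β ∘ φ from funext hsβ]
    exact hβ.comp hφ.tendsto_atTop
  obtain ⟨k₁, hk₁⟩ := (tendsto_atTop.1 hβ' 0).exists_forall_of_atTop
  refine ⟨C, p, s, max k₀ k₁, hC, fun k hk => ⟨(hsL k).2, ?_⟩⟩
  intro n m v q z f F hm hbox hz hf hF
  have hk₀ : k₀ ≤ k := (le_max_left _ _).trans hk
  have hβk : 0 ≤ sch.β k := hk₁ k ((le_max_right _ _).trans hk)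
  obtain ⟨hnn, hle⟩ := stub_chessboard G r sch k m hβk hm v n q z f F hbox hz hf hF
  refine hle.trans (Finset.prod_le_prod (fun i _ => arrayRoot_nonneg r _ _ _ _ _ _ _ _ (hnn i)) fun i _ => ?_)
  have h := hCB k hk₀ (sch.L k) (hsL k).1 (hsL k).2 m v (z i) (q i) (f i) hm (hbox i) (by rw [← hsa]; exact hf i)
  simpa only [hsa, hsβ] using h

/-- **Child 2 re-assembled** (`stub_uvPackageVol` of the dead line, verbatim the second hypothesis of the landed
`ContinuumLegGivenGap_of_subs_all`): the IR/symmetry socket supplies `r`, the engine data and (ND) ∧ (ROT); the array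
exponent bound supplies a volume threshold `Λ`; the admissible torus family is `𝓛 k = {L ≥ Λ k, 2L+1 = 3^M}` (cofinal,
inside the clustering regime, of polynomial growth); on it (UUVB) follows from (CHESS), (CB) and the Whitney step.
[folklore] -/
theorem uvEngine_of_stubs :
    ∀ (G : Type) [Group G] [TopologicalSpace G] [IsTopologicalGroup G] [CompactSpace G]
      [MeasurableSpace G] [BorelSpace G], IsCompactSimpleLieGroup G → ∃ r : LatticeRep G,
      ∀ (β : ℕ → ℝ) (mh : ℕ → ℝ) (S₁ : ℕ → ℕ) (K : ℝ), Tendsto β atTop atTop → (∀ k, 0 < mh k) → 0 < K →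
      (∀ A B : YMSpecies G, ∃ C : ℝ, ∀ k S n : ℕ, S₁ k ≤ S → n ≤ S →
        |latticeConnectedCorr r.ρ (β k) (2 * S + 1) A.F B.F n| ≤ C * Real.exp (-(mh k * n))) →
      (∀ k S₀ : ℕ, ∃ A B : YMSpecies G, ∀ C : ℝ, ∃ S n : ℕ, S₀ ≤ S ∧ n ≤ S ∧
        C * Real.exp (-(K * mh k * n)) < |latticeConnectedCorr r.ρ (β k) (2 * S + 1) A.F B.F n|) →
      Tendsto mh atTop (𝓝 0) →
      ∃ (a : ℕ → ℝ) (φ : ℕ → ℕ) (Δ₀ : ℝ) (𝓛 : ℕ → Set ℕ),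
        (∀ k, 0 < a k) ∧ StrictMono φ ∧ 0 < Δ₀ ∧ (∀ k, Δ₀ * a k ≤ mh (φ k)) ∧
        (∀ k S : ℕ, ∃ S' : ℕ, S' ∈ 𝓛 k ∧ S ≤ S') ∧ (∀ k : ℕ, ∀ S ∈ 𝓛 k, S₁ (φ k) ≤ S) ∧
        (∃ N : ℕ, 1 ≤ N ∧ ∀ᶠ k in atTop, ∀ S ∈ 𝓛 k, (a k)⁻¹ ≤ (a k * (S : ℝ)) ^ N) ∧
      ∀ (sch : SpeciesScheme (YMSpecies G)), (∀ k, sch.a k = a k) → (∀ k, sch.β k = β (φ k)) →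
        (∀ k, sch.L k ∈ 𝓛 k) →
      ∀ (LS : (k n : ℕ) → SchwartzMap (Fin n → EuclideanSpace ℝ (Fin 4)) ℂ → ℂ),
      (∀ (k n : ℕ) (F : SchwartzMap (Fin n → EuclideanSpace ℝ (Fin 4)) ℂ), LS k n F =
        ∫ U : GaugeConfig 4 (sch.side k) G, ∑ x : Fin n → ↥(Literature.Probability.LatticeModels.box 4 (sch.L k)),
          F (fun i => sch.a k • siteToE ↑(x i)) *
            ∏ i, ((sch.c r.curvature k * sch.a k ^ 4 *
              (r.curvature.F (Literature.MathematicalPhysics.QuantumLattice.configShift (-↑(x i)) (Literature.MathematicalPhysics.QuantumLattice.torusLift (sch.side k) U)) - sch.m r.curvature k) : ℝ) : ℂ)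
          ∂(wilsonMeasure r.ρ (sch.β k))) →
      (∀ k : ℕ, sch.m r.curvature k =
        ∫ U : GaugeConfig 4 (sch.side k) G, r.curvature.F (Literature.MathematicalPhysics.QuantumLattice.torusLift (sch.side k) U) ∂(wilsonMeasure r.ρ (sch.β k))) →
      (∀ k : ℕ, sch.c r.curvature k = (sch.a k ^ 4)⁻¹) →
      (∃ (s : ℕ) (α β' : ℝ), ∀ᶠ k in atTop, ∀ (p : ℕ) (q : Fin p → {q : Fin 4 × Fin 4 // q.1 < q.2})
        (F : SchwartzMap (Fin p → EuclideanSpace ℝ (Fin 4)) ℂ), IsOffDiagonal F →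
        ‖∫ U : GaugeConfig 4 (sch.side k) G, ∑ x : Fin p → ↥(Literature.Probability.LatticeModels.box 4 (sch.L k)),
            F (fun i => sch.a k • siteToE ↑(x i)) *
              ∏ i, ((plaquetteObs r.ρ 0 (q i).1.1 (q i).1.2 (Literature.MathematicalPhysics.QuantumLattice.configShift (-↑(x i)) (Literature.MathematicalPhysics.QuantumLattice.torusLift (sch.side k) U)) -
                wilsonTorusMean r.ρ (sch.β k) (sch.L k) (plaquetteObs r.ρ 0 (q i).1.1 (q i).1.2) : ℝ) : ℂ)
            ∂(wilsonMeasure r.ρ (sch.β k))‖ ≤ α * (p.factorial : ℝ) ^ β' * schwartzNorm (p * s) F) ∧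
      (∃ (f g : SchwartzMap (Fin 1 → EuclideanSpace ℝ (Fin 4)) ℂ)
        (H : SchwartzMap (Fin (1 + 1) → EuclideanSpace ℝ (Fin 4)) ℂ),
        IsTimeOrdered f ∧ IsTimeOrdered g ∧ IsAppendTensorOf H (osAdjoint f) g ∧
          ∃ δ : ℝ, 0 < δ ∧ ∀ᶠ k in atTop, δ ≤ ‖LS k (1 + 1) H‖) ∧
      (∀ R : EuclideanSpace ℝ (Fin 4) ≃ₗᵢ[ℝ] EuclideanSpace ℝ (Fin 4),
        R (EuclideanSpace.single 0 1) =
          (3 / 5 : ℝ) • EuclideanSpace.single 0 1 + (-(4 / 5) : ℝ) • EuclideanSpace.single 1 1 →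
        R (EuclideanSpace.single 1 1) =
          (4 / 5 : ℝ) • EuclideanSpace.single 0 1 + (3 / 5 : ℝ) • EuclideanSpace.single 1 1 →
        R (EuclideanSpace.single 2 1) = EuclideanSpace.single 2 1 →
        R (EuclideanSpace.single 3 1) = EuclideanSpace.single 3 1 →
        ∀ (n : ℕ) (F : SchwartzMap (Fin n → EuclideanSpace ℝ (Fin 4)) ℂ), IsOffDiagonal F →
          Tendsto (fun k : ℕ => LS k n (linActMulti R F) - LS k n F) atTop (𝓝 0)) := by
  intro G _ _ _ _ _ _ hG
  obtain ⟨r, hr⟩ := stub_floorAndRotation G hG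
  refine ⟨r, ?_⟩
  intro β mh S₁ K hβ hmh hK hU hS hcrit
  obtain ⟨a, φ, Δ₀, Λ₀, ha, hφ, hΔ₀, hpin, hS₁, ⟨N, hN1, hpoly⟩, hIR⟩ :=
    hr β mh S₁ K hβ hmh hK hU hS hcrit
  obtain ⟨Λ, C, p, s, k₀, hΛ, hC, hCB⟩ :=
    stub_arrayExponent G hG r β mh S₁ hβ hmh hU a φ Δ₀ Λ₀ ha hφ hΔ₀ hpin hS₁
  refine ⟨a, φ, Δ₀, fun k => {L | Λ k ≤ L ∧ IsTriadic L}, ha, hφ, hΔ₀, hpin, ?_, ?_, ?_, ?_⟩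
  · -- cofinal
    intro k S
    obtain ⟨L, hL, hT⟩ := exists_triadic_ge (max S (Λ k))
    exact ⟨L, ⟨(le_max_right _ _).trans hL, hT⟩, (le_max_left _ _).trans hL⟩
  · -- inside the clustering regime
    intro k S hSk
    exact (hS₁ k).trans ((hΛ k).trans hSk.1)
  · -- polynomial volume growth (inherited from the tail `L ≥ Λ₀ k`)
    exact ⟨N, hN1, hpoly.mono fun k hk S hSk => hk S ((hΛ k).trans hSk.1)⟩
  intro sch hsa hsβ hsL LS hLS hm hc
  have hL₀ : ∀ k, Λ₀ k ≤ sch.L k := fun k => (hΛ k).trans (hsL k).1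
  obtain ⟨hND, hROT⟩ := hIR sch hsa hsβ hL₀ LS hLS hm hc
  refine ⟨?_, hND, hROT⟩
  -- (UUVB) from (CHESS), (CB) and the Whitney step
  have hPVG : PolyVolumeGrowth sch := by
    refine ⟨N, hN1, hpoly.mono fun k hk => ?_⟩
    rw [hsa]
    exact hk (sch.L k) (hL₀ k)
  have hPB : ProductBound r sch :=
    productBound_of_chessboard_of_exponent r sch hsa hsβ (fun k => hsL k) hβ hφ hC hCB
  have hUU : UUVB r sch := stub_productToUniform G r sch hPVG hPB
  obtain ⟨s', α, β', h⟩ := hUU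
  exact ⟨s', α, β', h⟩

/-- **`ContinuumLegGivenGap_of`** — the skeleton theorem: the crux for the seat's route `ComplexCouplingChannel`, BY
NAME, from criticality `XiDiverges` (stmt-QuantumFields-8941, by name), the five stubs, and the landed split
`ContinuumLegGivenGap_of_subs_all`. [folklore] -/
theorem ContinuumLegGivenGap_of (hXi : DirichletWindow.XiDiverges) : ComplexCouplingChannel.ContinuumLegGivenGap :=
  (Summit.QuantumFields.YangMills.Theorems.ContinuumLegGivenGap.ContinuumLegGivenGap_of_subs_all hXi
    uvEngine_of_stubs stub_skewWindow).1

/-- Twin: route `ConvexGribovBody`. [folklore] -/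
theorem ConvexGribovBody_ContinuumLegGivenGap_of (hXi : DirichletWindow.XiDiverges) :
    ConvexGribovBody.ContinuumLegGivenGap :=
  (Summit.QuantumFields.YangMills.Theorems.ContinuumLegGivenGap.ContinuumLegGivenGap_of_subs_all hXi
    uvEngine_of_stubs stub_skewWindow).2.1

/-- Twin: route `SmallCircleAnchor`. [folklore] -/
theorem SmallCircleAnchor_ContinuumLegGivenGap_of (hXi : DirichletWindow.XiDiverges) :
    SmallCircleAnchor.ContinuumLegGivenGap :=
  (Summit.QuantumFields.YangMills.Theorems.ContinuumLegGivenGap.ContinuumLegGivenGap_of_subs_all hXi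
    uvEngine_of_stubs stub_skewWindow).2.2.1

/-- Twin: route `HyperbolicRegulator`. [folklore] -/
theorem HyperbolicRegulator_ContinuumLegGivenGap_of (hXi : DirichletWindow.XiDiverges) :
    HyperbolicRegulator.ContinuumLegGivenGap :=
  (Summit.QuantumFields.YangMills.Theorems.ContinuumLegGivenGap.ContinuumLegGivenGap_of_subs_all hXi
    uvEngine_of_stubs stub_skewWindow).2.2.2.1

/-- Twin: route `ContractibleFibre` (`WeakCouplingContinuumLeg`). [folklore] -/
theorem ContractibleFibre_WeakCouplingContinuumLeg_of (hXi : DirichletWindow.XiDiverges) :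
    ContractibleFibre.WeakCouplingContinuumLeg :=
  (Summit.QuantumFields.YangMills.Theorems.ContinuumLegGivenGap.ContinuumLegGivenGap_of_subs_all hXi
    uvEngine_of_stubs stub_skewWindow).2.2.2.2.1

/-- Twin: route `DoublingDefect`. [folklore] -/
theorem DoublingDefect_ContinuumLegGivenGap_of (hXi : DirichletWindow.XiDiverges) :
    DoublingDefect.ContinuumLegGivenGap :=
  (Summit.QuantumFields.YangMills.Theorems.ContinuumLegGivenGap.ContinuumLegGivenGap_of_subs_all hXi
    uvEngine_of_stubs stub_skewWindow).2.2.2.2.2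

/-- Twin: route `NoiseSynchronisation` (character-identical seventh declaration of the shared item). [folklore] -/
theorem NoiseSynchronisation_ContinuumLegGivenGap_of (hXi : DirichletWindow.XiDiverges) :
    NoiseSynchronisation.ContinuumLegGivenGap :=
  ConvexGribovBody_ContinuumLegGivenGap_of hXi

end Composition

end Summit.QuantumFields.YangMills.Cruxes.ContinuumLegGivenGap.AlternatingCurvatureArrays

end
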